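import Summits.FinalStateConjecture.FinalStateConjecture.Theorems.EIHFluxBalanceInertialRecessionStubRechart3HoleLimit
import Summits.FinalStateConjecture.FinalStateConjecture.Theorems.EIHFluxBalanceInertialRecessionStubRechart3Clamp
import Summits.FinalStateConjecture.FinalStateConjecture.Theorems.EIHFluxBalanceInertialRecessionStubRechart3Injective
import Summits.FinalStateConjecture.FinalStateConjecture.Theorems.EIHFluxBalanceInertialRecessionStubRechart3Admissible

/-!
# Route EIHFluxBalance — `InertialRecession`, re-charting: the clock-chart package of a hole

Helper file for the crux `stmt-FinalStateConjecture-10166`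
(`Summit.FinalStateConjecture.FinalStateConjecture.Theses.EIHFluxBalance.InertialRecession`),
line `sublinear-is-free-clean-window-charges`, stub `stub_rechart` (the transfer P2), part G1.

`clockChart_package` — **the analytic hole-chart package for GENERAL painted frames and spins**
(the clock-chart counterpart of `hole_chart_package'` of `…HolePackage`, which covers `a = 0` with
convergent lab velocities). For hole `i` it delivers, in the REST frame: a proper-time clock `T₀`,
a smooth clamp profile `ρ'`, the clamp `C` and the re-charting map `A = ψ ∘ C` (`ψ` the honest chart
of the normalised frame), with: `A` a smooth open embedding of `E4`; every chart point late
(`Tl < (A y)⁰`) and within `(4γ+16γ²)‖(C y)~‖ < 2(4γ+16γ²)ρ'` of the own centre; on the rest exterior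
all painted radii exceed the horizon radii (so `A` maps into the lab chart's domain); `A = ψ` near
every late point of bounded offset; and near-zone `C²` convergence of `Φ ∘ A` to `g_{Mᵢ,aᵢ}` for every
fixed radius (`…HoleLimit`). The final boost is added by `…BoostTransport`. [folklore]
-/

noncomputable section

set_option linter.dupNamespace false

open Set Filter Function Metric Topology TopologicalSpace
open scoped ContDiff Manifold ENNReal BigOperators
open Literature.Geometry.Lorentzian

namespace Summit.FinalStateConjecture.FinalStateConjecture.Theorems.SublinearIsFree.Rechart

-- the assembly is long
set_option maxHeartbeats 1600000 in
/-- **The clock-chart package of hole `i`.** See the module docstring. [folklore] -/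
theorem clockChart_package
    (𝓢 : Spacetime 4) {N : ℕ} (i : Fin N) (M a : Fin N → ℝ) (Λ : Fin N → ℝ → lorentzGroup)
    (ξ : Fin N → ℝ → E3) (Λt : Fin N → ℝ → lorentzGroup)
    (hbil : ∀ j t x, boostedKerrBilin (Λt j t) (E4.ofTimeSpace t (ξ j t)) (M j) (a j) x =
      boostedKerrBilin (Λ j t) (E4.ofTimeSpace t (ξ j t)) (M j) (a j) x)
    (hrad : ∀ j t x, Kerr.radius (a j) (poincareInv (Λt j t) (E4.ofTimeSpace t (ξ j t)) x) =
      Kerr.radius (a j) (poincareInv (Λ j t) (E4.ofTimeSpace t (ξ j t)) x))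
    {H : Fin N → E4 → E4 →L[ℝ] E4 →L[ℝ] ℝ}
    (hH : ∀ j z, H j z = boostedKerrBilin (Λ j (z 0)) (E4.ofTimeSpace (z 0) (ξ j (z 0))) (M j) (a j) z -
      Minkowski.bilin)
    {Bb : E4 → E4 →L[ℝ] E4 →L[ℝ] ℝ} (hBb : ∀ z, Bb z = Minkowski.bilin + ∑ j, H j z)
    (hΛ : ∀ j, ContDiff ℝ ∞ (fun t ↦ ((Λ j t : E4 ≃L[ℝ] E4) : E4 →L[ℝ] E4)))
    (hξ : ∀ j, ContDiff ℝ ∞ (ξ j))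
    (hΛt : ∀ j, ContDiff ℝ ∞ (fun t ↦ ((Λt j t : E4 ≃L[ℝ] E4) : E4 →L[ℝ] E4)))
    (hdec : ∀ j m, 1 ≤ m → m ≤ 3 → Tendsto (fun t ↦ iteratedDeriv m
      (fun s ↦ ((Λt j s : E4 ≃L[ℝ] E4) : E4 →L[ℝ] E4)) t) atTop (𝓝 0))
    {γ : ℝ} (hγ1 : 1 ≤ γ) (huγ : ∀ j t, |((Λt j t : E4 ≃L[ℝ] E4) (E4.basisVector 0)) 0| ≤ γ)
    (hpos : ∀ j t, 0 < ((Λt j t : E4 ≃L[ℝ] E4) (E4.basisVector 0)) 0)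
    (hmis : ∀ j, ∀ m : ℕ, m ≤ 2 → Tendsto (fun t ↦ iteratedDeriv m (fun s ↦ deriv (ξ j) s -
      ((((Λt j s : E4 ≃L[ℝ] E4) (E4.basisVector 0)) 0)⁻¹ •
        E4.spatial ((Λt j s : E4 ≃L[ℝ] E4) (E4.basisVector 0)))) t) atTop (𝓝 0))
    (hsep : ∀ j ≠ i, Tendsto (fun t ↦ ‖ξ i t - ξ j t‖) atTop atTop)
    (U : Opens E4) (Φ : U → 𝓢.carrier) (hΦ : ContMDiff 𝓘(ℝ, E4) (𝓡 4) ∞ Φ)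
    (hdev : Tendsto (fun t ↦ 𝓢.deviationCk ⟨U, Bb, fun z ↦ z 0, E4.spatialNorm⟩ Φ 3 t) atTop (𝓝 0))
    {τ₀ : ℝ} {rin : Fin N → ℝ} (hrin : ∀ j, rin j < Kerr.rPlus (M j) (a j))
    (hU : {x : E4 | τ₀ < x 0 ∧ ∀ j, rin j < Kerr.radius (a j)
      (poincareInv (Λ j (x 0)) (E4.ofTimeSpace (x 0) (ξ j (x 0))) x)} ⊆ (U : Set E4))
    (hrPlus : 0 < Kerr.rPlus (M i) (a i)) (Tl : ℝ) (hTl : τ₀ ≤ Tl) :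
    ∃ (T₀ : ℝ → ℝ) (ρ' : ℝ → ℝ) (C A : E4 → E4)
      (hAU : ∀ y ∈ boostedKerrExterior 1 0 (M i) (a i), A y ∈ U),
      ContDiff ℝ ∞ T₀ ∧ (∀ τ, HasDerivAt T₀ (frameVel (Λt i (T₀ τ)) 0) τ) ∧
      (∀ σ τ, σ ≤ τ → τ - σ ≤ T₀ τ - T₀ σ ∧ T₀ τ - T₀ σ ≤ γ * (τ - σ)) ∧
      ContDiff ℝ ∞ ρ' ∧ (∀ s, 2 * (Kerr.rPlus (M i) (a i) + |a i|) + 3 ≤ ρ' s) ∧ Tendsto ρ' atTop atTop ∧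
      ContDiff ℝ ∞ C ∧ (∀ y, y 0 ≤ C y 0) ∧ (∀ y, ‖E4.spatial (C y)‖ < 2 * ρ' (C y 0)) ∧
      (∀ y, ‖E4.spatial (C y)‖ ≤ ‖E4.spatial y‖) ∧ (∀ y, ρ' (C y 0) ^ 2 ≤ C y 0) ∧
      (∀ y, A y = honestChart (Λt i) (ξ i) T₀ (C y)) ∧
      ContDiff ℝ ∞ A ∧ Topology.IsOpenEmbedding A ∧
      (∀ y, Tl < A y 0) ∧ (∀ y, |A y 0 - T₀ (C y 0)| ≤ 4 * γ * ‖E4.spatial (C y)‖) ∧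
      (∀ y, ‖E4.spatial (A y) - ξ i (A y 0)‖ ≤ (4 * γ + (4 * γ) ^ 2) * ‖E4.spatial (C y)‖) ∧
      (∀ y ∈ boostedKerrExterior 1 0 (M i) (a i), ∀ j, Kerr.rPlus (M j) (a j) <
        Kerr.radius (a j) (poincareInv (Λ j (A y 0)) (E4.ofTimeSpace (A y 0) (ξ j (A y 0))) (A y))) ∧
      (∃ Tc : ℝ, ∀ y : E4, Tc + 1 < y 0 → ‖E4.spatial y‖ < ρ' (y 0) / 2 →
        A =ᶠ[𝓝 y] honestChart (Λt i) (ξ i) T₀) ∧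
      (∀ K : ℝ, ∃ τK : ℝ, ∀ y : E4, τK ≤ y 0 → ‖E4.spatial y‖ ≤ K →
        A =ᶠ[𝓝 y] honestChart (Λt i) (ξ i) T₀) ∧
      ∀ (Ψ₁ : boostedKerrExterior 1 0 (M i) (a i) → 𝓢.carrier), (∀ y, Ψ₁ y = Φ ⟨A y.1, hAU y.1 y.2⟩) →
        ∀ R : ℝ, Tendsto (fun τ ↦ 𝓢.truncDeviationCk (boostedKerrBackground 1 0 (M i) (a i)) Ψ₁ 2 R τ)
          atTop (𝓝 0) := by
  have hγ0 : 0 ≤ γ := zero_le_one.trans hγ1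
  -- frame velocity of hole `i`
  have hu1 : ∀ t, 1 ≤ frameVel (Λt i t) 0 := fun t ↦ by
    have h := one_le_abs_lorentz_apply_zero (Λt i t)
    rw [abs_of_pos (hpos i t)] at h; exact h
  have huγ' : ∀ t, frameVel (Λt i t) 0 ≤ γ := fun t ↦ by
    have h := huγ i t; rw [abs_of_pos (hpos i t)] at h; exact h
  -- the clock
  have hfc : ContDiff ℝ ∞ (fun t ↦ frameVel (Λt i t) 0) :=
    (EuclideanSpace.proj (0 : Fin 4) : E4 →L[ℝ] ℝ).contDiff.comp (contDiff_frameVel (Λt i) (hΛt i))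
  obtain ⟨T₀, hT₀, hclock, -, hT₀m, -, hT₀lo, hT₀hi⟩ := exists_properTimeClock' hfc hu1 huγ' 0 0
  have hmono : Monotone T₀ := hT₀m.monotone
  have hT₀inf : Tendsto T₀ atTop atTop := by
    refine tendsto_atTop_mono' atTop ?_ (tendsto_atTop_add_const_right atTop (T₀ 0) tendsto_id)
    filter_upwards [eventually_ge_atTop 0] with τ hτ
    have := hT₀lo 0 τ hτ
    show τ + T₀ 0 ≤ T₀ τ
    linarith
  -- the admissible profile
  set ρmin : ℝ := 2 * (Kerr.rPlus (M i) (a i) + |a i|) + 2 with hρmin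
  have hρmin0 : 0 ≤ ρmin := by rw [hρmin]; positivity
  obtain ⟨ρ, hρc, hρ1, hρt, hρadm⟩ := exists_admissible_profile i M a ξ (Λt i) T₀ (hΛt i) (hdec i) hγ1 (huγ i)
    (hpos i) (hξ i) (hmis i) hsep hT₀inf ρmin Tl hρmin0
  obtain ⟨sA, hsA⟩ := eventually_atTop.mp hρadm
  set ρ' : ℝ → ℝ := fun s ↦ ρ s + ρmin with hρ'
  have hρ'c : ContDiff ℝ ∞ ρ' := hρc.add contDiff_const
  have hρ'pos : ∀ s, 0 < ρ' s := fun s ↦ by rw [hρ']; simp only; linarith [hρ1 s]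
  have hρ'max : ∀ s, max (ρ s) 0 + ρmin = ρ' s := fun s ↦ by
    rw [max_eq_left (zero_le_one.trans (hρ1 s))]
  -- the clamps
  obtain ⟨σ, hσc, hσm, hσ1, hσid, hσle, hσ'⟩ := exists_strictTimeClamp'
  obtain ⟨Gt, hGt, hGm, hGlt, hGid, hGgt, hGle, hGd⟩ := exists_coordClamp'
  set Tc : ℝ := max sA 0 with hTc
  set θ : ℝ → ℝ := fun s ↦ Tc + 1 + σ (s - Tc - 1) with hθ
  have hθc : ContDiff ℝ ∞ θ := contDiff_const.add (hσc.comp ((contDiff_id.sub contDiff_const).sub contDiff_const))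
  have hθ' : ∀ w, 0 < deriv θ w := by
    intro w
    have hσd : Differentiable ℝ σ := hσc.differentiable (by simp)
    have h1 : HasDerivAt θ (deriv σ (w - Tc - 1) * 1) w := by
      have h := ((hσd (w - Tc - 1)).hasDerivAt).comp w
        (((hasDerivAt_id w).sub_const Tc).sub_const 1)
      exact (h.const_add (Tc + 1))
    rw [h1.deriv, mul_one]; exact hσ' _
  have hθgt : ∀ s, Tc < θ s := fun s ↦ by rw [hθ]; simp only; linarith [hσ1 (s - Tc - 1)]
  have hθge : ∀ s, s ≤ θ s := fun s ↦ by rw [hθ]; simp only; linarith [hσle (s - Tc - 1)]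
  have hθid : ∀ s, Tc + 1 ≤ s → θ s = s := fun s hs ↦ by
    rw [hθ]; simp only; rw [hσid _ (by linarith)]; ring
  have hθadm : ∀ s, sA ≤ θ s := fun s ↦ ((le_max_left _ _).trans (hθgt s).le)
  -- the clamp map and the re-charting map
  set C : E4 → E4 := clampMap θ ρ' Gt with hC
  set A : E4 → E4 := fun y ↦ honestChart (Λt i) (ξ i) T₀ (C y) with hA
  have hψc : ContDiff ℝ ∞ (honestChart (Λt i) (ξ i) T₀) := contDiff_honestChart (Λt i) (ξ i) T₀ (hΛt i) (hξ i) hT₀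
  have hCc : ContDiff ℝ ∞ C := contDiff_clampMap hθc hρ'c hρ'pos hGt
  have hAc : ContDiff ℝ ∞ A := hψc.comp hCc
  have hC0 : ∀ y, C y 0 = θ (y 0) := fun y ↦ clampMap_apply_zero θ ρ' Gt y
  have hCsp : ∀ y, ‖E4.spatial (C y)‖ < 2 * ρ' (C y 0) := fun y ↦ by
    rw [hC0]; exact norm_spatial_clampMap_lt hρ'pos hGlt y
  have hCle : ∀ y, ‖E4.spatial (C y)‖ ≤ ‖E4.spatial y‖ := fun y ↦ norm_spatial_clampMap_le hρ'pos hGle y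
  -- admissibility at every clamped model time
  have hadm : ∀ y, _ := fun y : E4 ↦ hsA (θ (y 0)) (hθadm (y 0))
  -- lab time of the chart point
  have hA0 : ∀ y, A y 0 = clockMap (Λt i) T₀ (C y) := fun y ↦ honestChart_apply_zero (Λt i) (ξ i) T₀ (C y)
  have hAwin : ∀ y, |A y 0 - T₀ (C y 0)| ≤ 4 * γ * ‖E4.spatial (C y)‖ := fun y ↦ by
    rw [hA0]; exact abs_clockMap_sub_le (Λt i) T₀ (huγ i) (C y)
  have hAlate' : ∀ y, T₀ (θ (y 0)) - 8 * γ * ρ' (θ (y 0)) ≤ A y 0 := fun y ↦ by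
    have h1 := hAwin y
    rw [hC0] at h1
    have h2 : 4 * γ * ‖E4.spatial (C y)‖ ≤ 4 * γ * (2 * ρ' (θ (y 0))) := by
      have := hCsp y; rw [hC0] at this
      exact mul_le_mul_of_nonneg_left this.le (by positivity)
    have h3 := neg_abs_le (A y 0 - T₀ (θ (y 0)))
    linarith
  have hAlate : ∀ y, Tl < A y 0 := fun y ↦ by
    obtain ⟨h1, -, -, -, -⟩ := hadm y
    rw [hρ'max] at h1
    linarith [hAlate' y]
  -- spatial offset of the chart point
  have hAoff : ∀ y, ‖E4.spatial (A y) - ξ i (A y 0)‖ ≤ (4 * γ + (4 * γ) ^ 2) * ‖E4.spatial (C y)‖ := by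
    intro y
    rw [hA0, hA]
    simp only
    rw [spatial_honestChart, add_sub_cancel_left]
    set Tz := clockMap (Λt i) T₀ (C y)
    have h1 : ‖E4.spatial (purgedFrame (Λt i Tz) (E4.spatial (C y)))‖ ≤ ‖purgedFrame (Λt i Tz) (E4.spatial (C y))‖ :=
      (E4.spatial.le_opNorm _).trans
        ((mul_le_mul_of_nonneg_right norm_spatialCLM_le (norm_nonneg _)).trans (by rw [one_mul]))
    refine h1.trans (((purgedFrame (Λt i Tz)).le_opNorm _).trans ?_)
    refine mul_le_mul_of_nonneg_right ((norm_purgedFrame_le _).trans ?_) (norm_nonneg _)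
    have h4 := norm_frame_le_four_mul (Λt i) (huγ i) Tz
    have h5 : ‖((Λt i Tz : E4 ≃L[ℝ] E4) : E4 →L[ℝ] E4)‖ ^ 2 ≤ (4 * γ) ^ 2 := pow_le_pow_left₀ (norm_nonneg _) h4 2
    linarith
  -- painted radii at the chart point
  have hradii : ∀ y ∈ boostedKerrExterior 1 0 (M i) (a i), ∀ j, Kerr.rPlus (M j) (a j) <
      Kerr.radius (a j) (poincareInv (Λ j (A y 0)) (E4.ofTimeSpace (A y 0) (ξ j (A y 0))) (A y)) := by
    intro y hy j
    have hyext : y ∈ Kerr.exterior (M i) (a i) := by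
      rw [mem_boostedKerrExterior, poincareInv_one, sub_zero] at hy; exact hy
    have hr : Kerr.rPlus (M i) (a i) < Kerr.radius (a i) y := (le_max_left _ _).trans_lt (Kerr.mem_exterior.mp hyext)
    by_cases hj : j = i
    · subst hj
      rw [← hrad, hA0, hA]
      simp only
      rw [radius_poincareInv_honestChart]
      rcases radius_clampMap hρ'pos hGid hGgt (θ := θ) (a j) y with h | h
      · rw [h]; exact hr
      · have h2 : 2 * (Kerr.rPlus (M j) (a j) + |a j|) + 2 ≤ ρ' (θ (y 0)) := by
          rw [hρ']; simp only; linarith [hρ1 (θ (y 0))]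
        linarith
    · -- another hole: separation at the lab time of the chart point
      obtain ⟨-, -, -, h4, -⟩ := hadm y
      have hsepy := h4 (A y 0) (by rw [hρ'max]; exact hAlate' y) j hj
      rw [hρ'max] at hsepy
      have hoff := hAoff y
      have hCs : ‖E4.spatial (C y)‖ ≤ 2 * ρ' (θ (y 0)) := by have := hCsp y; rw [hC0] at this; exact this.le
      have hdist : Kerr.rPlus (M j) (a j) + |a j| + 1 ≤ ‖E4.spatial (A y) - ξ j (A y 0)‖ := by
        have h1 : ‖ξ i (A y 0) - ξ j (A y 0)‖ ≤ ‖E4.spatial (A y) - ξ j (A y 0)‖ + ‖E4.spatial (A y) - ξ i (A y 0)‖ := by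
          have := norm_sub_le_norm_sub_add_norm_sub (ξ i (A y 0)) (E4.spatial (A y)) (ξ j (A y 0))
          rw [norm_sub_rev (ξ i (A y 0)) (E4.spatial (A y))] at this
          linarith
        have h2 : (4 * γ + (4 * γ) ^ 2) * ‖E4.spatial (C y)‖ ≤ 2 * (4 * γ + (4 * γ) ^ 2) * ρ' (θ (y 0)) := by
          nlinarith [hCs, sq_nonneg γ]
        linarith
      have h := sub_abs_le_radius_poincareInv (Λ j (A y 0)) (a j) (x := A y) rfl (ξ j (A y 0))
      linarith
  -- the chart points lie in the lab chart's domain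
  have hAU : ∀ y ∈ boostedKerrExterior 1 0 (M i) (a i), A y ∈ U := fun y hy ↦
    hU ⟨hTl.trans_lt (hAlate y), fun j ↦ (hrin j).trans (hradii y hy j)⟩
  -- honesty near late points of small offset (quantitative) and of bounded offset
  have hhonq : ∀ y : E4, Tc + 1 < y 0 → ‖E4.spatial y‖ < ρ' (y 0) / 2 →
      A =ᶠ[𝓝 y] honestChart (Λt i) (ξ i) T₀ := by
    intro y hy1 hy2
    have hCid : C =ᶠ[𝓝 y] id := clampMap_eventuallyEq_id hρ'c hρ'pos hGid hθid hy1 hy2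
    filter_upwards [hCid] with z hz
    rw [hA]; simp only; rw [hz, id]
  have hhon : ∀ K : ℝ, ∃ τK : ℝ, ∀ y : E4, τK ≤ y 0 → ‖E4.spatial y‖ ≤ K →
      A =ᶠ[𝓝 y] honestChart (Λt i) (ξ i) T₀ := by
    intro K
    obtain ⟨sK, hsK⟩ := eventually_atTop.mp (hρt.eventually (eventually_gt_atTop (2 * K)))
    refine ⟨max (Tc + 2) sK, fun y hy hyK ↦ hhonq y ?_ ?_⟩
    · linarith [le_max_left (Tc + 2) sK]
    · have h1 := hsK (y 0) ((le_max_right _ _).trans hy)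
      rw [hρ']; simp only; linarith
  -- injectivity of the re-charting map
  have hinj : Injective A := by
    intro y₁ y₂ h
    have hCinj : Injective C := (isOpenEmbedding_clampMap hθc hθ' hρ'c hρ'pos hGt hGm hGd).injective
    refine hCinj ?_
    set z₁ := C y₁ with hz₁
    set z₂ := C y₂ with hz₂
    have h' : honestChart (Λt i) (ξ i) T₀ z₁ = honestChart (Λt i) (ξ i) T₀ z₂ := h
    -- equal lab times and spatial parts
    have ht : clockMap (Λt i) T₀ z₁ = clockMap (Λt i) T₀ z₂ := by
      have := congrArg (fun x : E4 ↦ x 0) h'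
      simpa only [honestChart_apply_zero] using this
    have hsp : E4.spatial z₁ = E4.spatial z₂ := by
      have h2 := congrArg E4.spatial h'
      rw [spatial_honestChart, spatial_honestChart, ht, add_right_inj] at h2
      exact injective_spatial_purgedFrame _ h2
    -- equal model times, by monotonicity of the slice function from the earlier point
    set s₀ : ℝ := min (z₁ 0) (z₂ 0) with hs₀
    have hs₀adm : sA ≤ s₀ := by
      rw [hs₀, hz₁, hz₂, hC0, hC0]; exact le_min (hθadm _) (hθadm _)
    obtain ⟨-, hINJ, -, -, -⟩ := hsA s₀ hs₀adm
    rw [hρ'max] at hINJ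
    have hw : ‖E4.spatial z₁‖ ≤ 2 * ρ' s₀ := by
      rcases min_choice (z₁ 0) (z₂ 0) with hm | hm
      · rw [hs₀, hm]; have := hCsp y₁; rw [← hz₁] at this; exact this.le
      · rw [hs₀, hm, hsp]; have := hCsp y₂; rw [← hz₂] at this; exact this.le
    have hδK : 1 / (4 * ρ' s₀) * (2 * ρ' s₀) ≤ 1 / 2 := by
      rw [div_mul_eq_mul_div, one_mul, div_le_iff₀ (by linarith [hρ'pos s₀])]; linarith [hρ'pos s₀]
    have hL' : ∀ s, T₀ s₀ ≤ s → ‖deriv (fun t ↦ frameTilt (Λt i t)) s‖ ≤ 1 / (4 * ρ' s₀) := by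
      intro s hs
      have h1 := hINJ s hs
      rw [le_div_iff₀ (by linarith [hρ'pos s₀])]; linarith
    have hmonoSl := strictMonoOn_clockSlice (Λt i) T₀ (hΛt i) hT₀ hclock hu1 (le_refl (T₀ s₀)) hδK hL' hw
    have heq : T₀ (z₁ 0) + frameTilt (Λt i (T₀ (z₁ 0))) (E4.spatial z₁) =
        T₀ (z₂ 0) + frameTilt (Λt i (T₀ (z₂ 0))) (E4.spatial z₁) := by
      have := ht; rw [clockMap, clockMap, ← hsp] at this; exact this
    have hm1 : z₁ 0 ∈ Ici s₀ := by rw [Set.mem_Ici, hs₀]; exact min_le_left _ _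
    have hm2 : z₂ 0 ∈ Ici s₀ := by rw [Set.mem_Ici, hs₀]; exact min_le_right _ _
    have h0 : z₁ 0 = z₂ 0 := hmonoSl.injOn hm1 hm2 heq
    rw [← E4.ofTimeSpace_time_spatial z₁, ← E4.ofTimeSpace_time_spatial z₂, E4.time_apply, E4.time_apply, h0, hsp]
  -- injectivity of the differential
  have hDinj : ∀ y, Injective (fderiv ℝ A y) := by
    intro y
    have hdiff : fderiv ℝ A y = (fderiv ℝ (honestChart (Λt i) (ξ i) T₀) (C y)).comp (fderiv ℝ C y) :=
      fderiv_comp y ((hψc.differentiable (by simp)) _) ((hCc.differentiable (by simp)) _)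
    rw [hdiff, ContinuousLinearMap.coe_comp]
    refine Injective.comp ?_ (injective_fderiv_clampMap hθc hθ' hρ'c hρ'pos hGt hGd y)
    -- the window at the clamped model time
    set s : ℝ := θ (y 0) with hs
    obtain ⟨-, -, hDER, -, -⟩ := hadm y
    rw [hρ'max] at hDER
    set δ : ℝ := 1 / (664 * γ ^ 4 * (1 + 2 * ρ' s) ^ 4 + 1) with hδ
    have hδ0 : 0 ≤ δ := by positivity
    have hδ1 : δ ≤ 1 := by
      rw [hδ, div_le_one (by positivity)]; nlinarith [pow_nonneg hγ0 4, pow_nonneg (by linarith [hρ'pos s] : (0:ℝ) ≤ 1 + 2 * ρ' s) 4]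
    have hz0 : C y 0 = s := hC0 y
    refine injective_fderiv_honestChart (Λt i) (ξ i) T₀ (hΛt i) (hξ i) hT₀ hclock hγ1 hu1 (huγ i) hδ0 hδ1
      (S := T₀ (s - 1) - 8 * γ * ρ' s)
      (fun t ht ↦ (hDER t ht).1) (fun t ht ↦ (hDER t ht).2.1) (fun t ht ↦ (hDER t ht).2.2.1)
      (fun t ht ↦ (hDER t ht).2.2.2.1) (fun t ht ↦ (hDER t ht).2.2.2.2.1) (fun t ht ↦ (hDER t ht).2.2.2.2.2.1)
      (fun t ht ↦ (hDER t ht).2.2.2.2.2.2.1) (fun t ht ↦ (hDER t ht).2.2.2.2.2.2.2.1)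
      (fun t ht ↦ (hDER t ht).2.2.2.2.2.2.2.2.1) (fun t ht ↦ (hDER t ht).2.2.2.2.2.2.2.2.2.1)
      (fun t ht ↦ (hDER t ht).2.2.2.2.2.2.2.2.2.2) (R := 2 * ρ' s) (τ₁ := s) (by linarith [hρ'pos s]) (by linarith)
      ?_ (by rw [hz0, sub_self, abs_zero]; exact zero_le_one) (by rw [← hz0]; exact (hCsp y).le)
    -- smallness: `332 γ⁴ (1+2ρ')⁴ / (664 γ⁴ (1+2ρ')⁴ + 1) < 1`
    have hX : 0 ≤ γ ^ 4 * (1 + 2 * ρ' s) ^ 4 := by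
      have := hρ'pos s; positivity
    have h1 : 83 * γ ^ 3 * (1 + 2 * ρ' s) ^ 4 * δ * (4 * γ) = 332 * (γ ^ 4 * (1 + 2 * ρ' s) ^ 4) * δ := by ring
    rw [h1, hδ, ← mul_div_assoc, mul_one, div_lt_one (by positivity)]
    linarith
  have hemb : Topology.IsOpenEmbedding A := isOpenEmbedding_of_injective_of_fderiv_injective hAc (by simp) hinj hDinj
  -- assemble
  refine ⟨T₀, ρ', C, A, hAU, hT₀, hclock, fun σ' τ h ↦ ⟨hT₀lo σ' τ h, hT₀hi σ' τ h⟩, hρ'c, fun s ↦ ?_, ?_, hCc,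
    fun y ↦ ?_, hCsp, hCle, fun y ↦ ?_, fun y ↦ rfl, hAc, hemb, hAlate, hAwin, hAoff, hradii, ⟨Tc, hhonq⟩, hhon, ?_⟩
  · rw [hρ']; simp only; linarith [hρ1 s]
  · exact tendsto_atTop_add_const_right _ _ hρt
  · rw [hC0]; exact hθge _
  · obtain ⟨-, -, -, -, h5⟩ := hadm y
    rw [hρ'max, ← hC0] at h5
    exact h5
  · intro Ψ₁ hΨ₁ R
    exact tendsto_truncDeviationCk_clockChart 𝓢 i M a Λ ξ Λt T₀ hbil hrad hH hBb hΛ hξ hΛt hdec hγ1 huγ hpos hmis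
      hsep hT₀ hclock hT₀inf U Φ hΦ hdev hAc hAU hΨ₁ hhon hrPlus R

/-- Registered one-line form (worker carrier `rechart_clockChart_smallness`). [folklore] -/
theorem rechart_clockChart_smallness : ∀ (X : ℝ), 0 ≤ X → 332 * X * (1 / (664 * X + 1)) < 1 := by
  intro X hX
  rw [← mul_div_assoc, mul_one, div_lt_one (by positivity)]
  linarith

end Summit.FinalStateConjecture.FinalStateConjecture.Theorems.SublinearIsFree.Rechart

end
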